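import Summits.QuantumFields.YangMills.Theses.SteinGapBootstrap
import Literature.MathematicalPhysics.QuantumFieldTheory.LatticeMaxwellBlockSteinRegularity
import Literature.MathematicalPhysics.QuantumFieldTheory.LatticeMaxwellBlockSteinInterpolation
import Summits.QuantumFields.YangMills.Theorems.EquipartitionCriticalityEquipartitionPinsProbeTangentPlaqFieldContinuous

/-!
# Route `SteinGapBootstrap`: Stein's lemma for the lattice-Maxwell pair-block law, modulo Stein's equation

Support item `SteinTransferPairG` (stmt-QuantumFields-23639; ≡ `USteinTransferPair`, stmt-QuantumFields-23799) of
route `SteinGapBootstrap` (`QuantumFields/YangMills`), the Stein seam of the crux U `FreeProbeLawG`: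
for every torus-limit state `μ`, every separation `n ≥ 1` and every `ε ≥ 0`, IF the pair law of the rescaled
plaquette field `Y^β_B = (plaqField r β · p a)_{p ∈ B, a}` on the pair block `B = {p₁₂(0), p₁₂(n e₀)}` nearly
annihilates the lattice-Maxwell block Ornstein–Uhlenbeck generator,
`|E_μ[(L_B F)(Y^β_B)]| ≤ ε (1 + M)` for all `C²` test functions `F` with `‖∇F‖ ≤ 1` and `M`-Lipschitz gradient,
THEN `|E_μ h(Y^β_B) − γ_B(h)| ≤ 2ε` for every smooth `h` with `‖∇h‖ ≤ 1`, `‖∇²h‖ ≤ 1`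
(`γ_B = latticeMaxwellBlockLaw B D`, the block marginal of the curvature Gaussian field).

This file proves the item MODULO the tree's named fact
`Literature.MathematicalPhysics.QuantumFieldTheory.Meckes2009_lemma1_steinEquation_latticeMaxwellBlock`
(Meckes 2009, Lemma 1 (3): `U_o h` solves Stein's equation `−L_B (U_o h) = h − γ_B(h)`):

* `steinSolution_factors` — for smooth `h` with `‖∇h‖ ≤ 1`, `‖∇²h‖ ≤ 1`, the Stein solution
  `F = U_o h = latticeMaxwellBlockStein B D h` is `C²` (tree `SteinOU.contDiff_two_steinInverse`), has `‖∇F‖ ≤ 1`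
  (first Stein factor, tree `lipschitzWith_latticeMaxwellBlockStein`) and `½`-Lipschitz gradient (Hessian Stein factor,
  tree `Meckes2009_lemma2_hessianSteinFactor_latticeMaxwellBlock_holds` with `M₂(h) ≤ 1`);
* `integrable_comp_plaqFieldBlock` — `U ↦ h(Y^β_B(U))` is integrable against every finite measure on the
  configuration space (continuous on the compact space `G^{edges}`, `G` second countable through `r`);
* `steinTransferPairG_of_steinEquation` — the item's statement, by name, from the named fact: test the hypothesis
  with `F := U_o h`, `M := ½` (`3ε/2 ≤ 2ε`) and integrate Stein's equation against the probability measure `μ`.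

Once `Meckes2009_lemma1_steinEquation_latticeMaxwellBlock_holds` is in the tree, `SteinTransferPairG` (and its alias
`USteinTransferPair`) close by the one-line application of `steinTransferPairG_of_steinEquation`.

Honest label: a support lemma of a route whose target is the RECORD rung `WeakCouplingRates.XiPow` (an upper bound on
the lattice gap exponent); no Yang–Mills mass gap and no summit is proved here.

References: E. Meckes, IMS Collections 5 (2009) 153–178, arXiv:0902.0333, Lemma 1 (3), Lemma 2 (1) [Meckes2009];
S. Chatterjee, E. Meckes, ALEA 4 (2008), arXiv:math/0701464 [ChatterjeeMeckes2007].
-/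

noncomputable section

open MeasureTheory
open Literature.Probability.LatticeModels Literature.MathematicalPhysics.QuantumLattice
open Literature.MathematicalPhysics.QuantumFieldTheory
open Summit.QuantumFields.YangMills.Theorems.EquipartitionPinsProbe

namespace Summit.QuantumFields.YangMills.Theorems.SteinGapBootstrap

/-! ### Stein factors of the Stein solution for a smooth `1`-Lipschitz test function -/

/-- **Stein factors of `U_o h` on a block of `ℤ⁴`.** For `h` smooth with `‖∇h‖ ≤ 1` and `‖∇²h‖ ≤ 1` on the block space
`↥B → Fin D → ℝ`, the Stein solution `F = U_o h = latticeMaxwellBlockStein B D h` is `C²`, satisfies `‖∇F‖ ≤ 1`, and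
its gradient is `½`-Lipschitz (Meckes 2009, Lemma 2 (1) for `k = 1, 2`: `M₁(U_o h) ≤ M₁(h)`, `M₂(U_o h) ≤ ½ M₂(h)`).
[cite: Meckes2009, Lemma 2 (1)] -/
theorem steinSolution_factors (B : Finset (ZdPlaquette 4)) (D : ℕ) {h : (↥B → Fin D → ℝ) → ℝ}
    (hh : ContDiff ℝ (⊤ : ℕ∞) h) (hDh : ∀ x, ‖fderiv ℝ h x‖ ≤ 1)
    (hD2h : ∀ x, ‖iteratedFDeriv ℝ 2 h x‖ ≤ 1) :
    ContDiff ℝ 2 (latticeMaxwellBlockStein B D h) ∧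
      (∀ x, ‖fderiv ℝ (latticeMaxwellBlockStein B D h) x‖ ≤ 1) ∧
      (∀ x y, ‖fderiv ℝ (latticeMaxwellBlockStein B D h) x - fderiv ℝ (latticeMaxwellBlockStein B D h) y‖ ≤
        1 / 2 * ‖x - y‖) := by
  have hd : (3 : ℕ) ≤ 4 := by norm_num
  haveI := isProbabilityMeasure_latticeMaxwellBlockLaw B D hd
  have hγ := integrable_norm_latticeMaxwellBlockLaw B D hd
  have h2 : ContDiff ℝ 2 h := contDiff_infty.mp hh 2
  have h1 : ContDiff ℝ 1 h := contDiff_infty.mp hh 1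
  have hC2 : ∀ x, ‖fderiv ℝ (fderiv ℝ h) x‖ ≤ 1 :=
    SteinOU.norm_fderiv_fderiv_le_of_iteratedFDeriv hD2h
  -- `h` is `1`-Lipschitz, hence so is `U_o h` (first Stein factor), hence `‖∇ U_o h‖ ≤ 1`.
  have hLip : LipschitzWith 1 h := by
    simpa using SteinOU.lipschitzWith_of_norm_fderiv_le h1 hDh
  have hLipU : LipschitzWith 1 (latticeMaxwellBlockStein B D h) :=
    lipschitzWith_latticeMaxwellBlockStein B D hd hLip
  -- `∇h` is `1`-Lipschitz (mean value inequality with `‖∇²h‖ ≤ 1`).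
  have hdiffDh : Differentiable ℝ (fderiv ℝ h) :=
    (h2.fderiv_right (m := 1) le_rfl).differentiable one_ne_zero
  have hLipDh : LipschitzWith 1 (fderiv ℝ h) := by
    refine lipschitzWith_of_nnnorm_fderiv_le hdiffDh fun x => ?_
    rw [← NNReal.coe_le_coe, coe_nnnorm]
    simpa using hC2 x
  have hM : ∀ x y, ‖fderiv ℝ h x - fderiv ℝ h y‖ ≤ 1 * ‖x - y‖ := fun x y => by
    simpa using hLipDh.norm_sub_le x y
  have hHess := (Meckes2009_lemma2_hessianSteinFactor_latticeMaxwellBlock_holds 4 D hd B h 1 h2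
    ⟨1, hDh⟩ hM).2
  refine ⟨?_, fun x => ?_, fun x y => ?_⟩
  · exact SteinOU.contDiff_two_steinInverse h2 hDh hC2 hγ
  · simpa using norm_fderiv_le_of_lipschitz ℝ (x₀ := x) hLipU
  · simpa using hHess x y

/-! ### Integrability of block observables of the rescaled plaquette field -/

section Integrable

variable {G : Type} [Group G] [TopologicalSpace G] [IsTopologicalGroup G] [CompactSpace G]
  [MeasurableSpace G] [BorelSpace G]

omit [CompactSpace G] [MeasurableSpace G] [BorelSpace G] in
/-- The block variables `U ↦ Y^β_B(U) = (plaqField r β U p a)_{p ∈ B, a}` depend continuously on the configuration.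
[cite: arXiv160201222, §9] -/
theorem continuous_plaqFieldBlock (r : LatticeRep G) (β : ℝ) (B : Finset (ZdPlaquette 4)) :
    Continuous fun U : LGConfig 4 G => fun (p : ↥B) (a : Fin (lieDim r)) => plaqField r β U (p : ZdPlaquette 4) a :=
  continuous_pi fun p => continuous_pi fun a =>
    TangentPlaqFieldContinuous.continuous_plaqField_apply r β (p : ZdPlaquette 4) a

/-- **A continuous observable of the block variables is bounded and integrable** against every finite measure on
the configuration space `G^{edges}` (compact; `G` is second countable because `r` is a faithful continuous matrix
representation, so continuous maps are measurable for the product σ-algebra). [folklore] -/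
theorem integrable_comp_plaqFieldBlock (r : LatticeRep G) (β : ℝ) (B : Finset (ZdPlaquette 4))
    (μ : Measure (LGConfig 4 G)) [IsFiniteMeasure μ] {h : (↥B → Fin (lieDim r) → ℝ) → ℝ} (hh : Continuous h) :
    Integrable (fun U : LGConfig 4 G => h (fun (p : ↥B) (a : Fin (lieDim r)) => plaqField r β U (p : ZdPlaquette 4) a)) μ := by
  haveI : SecondCountableTopology G :=
    (r.continuous.isClosedEmbedding r.injective).isEmbedding.secondCountableTopology
  have hcont : Continuous fun U : LGConfig 4 G =>
      h (fun (p : ↥B) (a : Fin (lieDim r)) => plaqField r β U (p : ZdPlaquette 4) a) :=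
    hh.comp (continuous_plaqFieldBlock r β B)
  obtain ⟨C, hC⟩ := isCompact_univ.exists_bound_of_continuousOn hcont.continuousOn
  exact Integrable.of_bound hcont.measurable.aestronglyMeasurable C
    (ae_of_all _ fun U => hC U (Set.mem_univ U))

end Integrable

/-! ### The item, modulo Stein's equation -/

/-- **`SteinTransferPairG` from Stein's equation (Meckes 2009, Lemma 1 (3)).** Given the named fact
`Meckes2009_lemma1_steinEquation_latticeMaxwellBlock` (`−L_B (U_o g) = g − γ_B(g)` for smooth `g` with bounded
`∇g`, `∇²g`), the route's support item `SteinTransferPairG` holds: test the generator-discrepancy hypothesis with the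
Stein solution `F := U_o h` (`C²`, `‖∇F‖ ≤ 1`, `∇F` `½`-Lipschitz by `steinSolution_factors`) to get
`|E_μ[(L_B U_o h)(Y^β_B)]| ≤ 3ε/2`, and integrate Stein's equation against the probability measure `μ`:
`E_μ[(L_B U_o h)(Y^β_B)] = −(E_μ h(Y^β_B) − γ_B(h))`; `3ε/2 ≤ 2ε`. [cite: Meckes2009, Lemma 1 (3) and Lemma 2 (1)] -/
theorem steinTransferPairG_of_steinEquation
    (hSE : Meckes2009_lemma1_steinEquation_latticeMaxwellBlock) :
    Summit.QuantumFields.YangMills.Theses.SteinGapBootstrap.SteinTransferPairG := by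
  intro G _ _ _ _ _hG
  letI : MeasurableSpace G := borel G
  haveI : BorelSpace G := ⟨rfl⟩
  intro r β μ hμ n hn ε hε B YB hF h hh hDh hD2h
  haveI : IsProbabilityMeasure μ := by obtain ⟨_, _, hprob, _⟩ := hμ; exact hprob
  obtain ⟨hC2F, hDF, hLipDF⟩ := steinSolution_factors B (lieDim r) hh hDh hD2h
  have key := hF (latticeMaxwellBlockStein B (lieDim r) h) (1 / 2) (by norm_num) hC2F hDF hLipDF
  -- Stein's equation, pointwise.
  have hSE' : ∀ y, latticeMaxwellBlockGenerator B (lieDim r) (latticeMaxwellBlockStein B (lieDim r) h) y =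
      -(h y - ∫ z, h z ∂latticeMaxwellBlockLaw B (lieDim r)) := fun y => by
    have := hSE 4 (lieDim r) (by norm_num) B h hh ⟨1, hDh⟩ ⟨1, hD2h⟩ y
    linarith
  have hint : Integrable (fun U => h (YB U)) μ :=
    integrable_comp_plaqFieldBlock r β B μ hh.continuous
  have hLHS : ∫ U, latticeMaxwellBlockGenerator B (lieDim r) (latticeMaxwellBlockStein B (lieDim r) h) (YB U) ∂μ =
      -((∫ U, h (YB U) ∂μ) - ∫ z, h z ∂latticeMaxwellBlockLaw B (lieDim r)) := by
    simp only [hSE']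
    rw [integral_neg, integral_sub hint (integrable_const _), integral_const, smul_eq_mul, probReal_univ,
      one_mul]
  rw [hLHS, abs_neg] at key
  calc |(∫ U, h (YB U) ∂μ) - ∫ z, h z ∂latticeMaxwellBlockLaw B (lieDim r)| ≤ ε * (1 + 1 / 2) := key
    _ ≤ 2 * ε := by linarith

end Summit.QuantumFields.YangMills.Theorems.SteinGapBootstrap

end
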